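import Summits.ABC.ABC.Theses.DefiniteXi
import Summits.ABC.ABC.Theorems.FreyDegreeBound.Negative.LevelAndConductor
import Summits.ABC.ABC.Theorems.SteinbergCore.Negative.SteinbergCoreDomain
import Literature.NumberTheory.EllipticCurves.ModularDegreeMinimal
import HarnessLib

/-!
# Crux `SteinbergCore` (stmt-ABC-15024), line `p6_tamagawa_split` — the guard `0 < ε` of the atom
# `stub_primeToSixDegreeBound` is LOAD-BEARING

The abc-strength stub of the registered skeleton of stmt-ABC-15024 (child `PrimeToSixDegreeBound` of the
prepared split): for every `ε > 0` there is `C` such that for all coprime `a, b` (`ab(a+b) ≠ 0`), `N` the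
conductor of `E_(a,b) = freyCurve a b`, and every datum `D` of minimal degree of `E_(a,b)` at level `N`,
`cps (deg D) ≤ C N^(2+ε)` (`cps n = n / (2^{v₂ n} 3^{v₃ n})`).

`primeToSixDegreeBound_false_without_eps_pos` — **granting `FreyModularity` (stmt-ABC-11340, Wiles/BCDT), the
stub with the guard `0 < ε` dropped is FALSE**: at `ε = −3` it asks for `cps (deg D) ≤ C / N`, but a minimal
datum exists on every Frey curve (`FreyModularity` + `exists_minimal_datum`), has `cps (deg D) ≥ 1`
(`deg_pos`, `1 ≤ cps n ↔ n ≠ 0`), and conductors of Frey curves are unbounded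
(`FreyDegreeBound.Negative.conductorNorm_freyCurve_unbounded`: `p ≤ 2 N(E_(1,p))`).  This is the twin, for the
Brandt-free atom in the minimal-datum idiom, of the disprover's `steinbergCore_false_without_eps_pos` for the crux
`B` itself (`Cruxes/SteinbergCore/Disproof.lean` §D, which needs Takahashi's theorem and optimal data instead);
here the only input beyond the tree is the route item `FreyModularity`.  It refutes the TTRL variant V3765
(`drop_hyp:0`) of the stub modulo that item.  Test for whoever files child 2 of the split: keep `0 < ε` (the
exponent `2` itself is conjecturally sharp, Masser 1990, and not attacked here).
-/

-- `Summit.<Summit>.<Problem>` is the mandated summit-side namespace (CONVENTIONS §2); for the single-conjunct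
-- summit `ABC` the two coincide, so the duplicate `ABC.ABC` is deliberate.
set_option linter.dupNamespace false

noncomputable section

namespace Summit.ABC.ABC.Theorems.SteinbergCorePrimeToSixEpsPos

open Literature.NumberTheory.EllipticCurves Literature.NumberTheory.EllipticCurves.ModularForms
open Summit.ABC.ABC.Theses.DefiniteXi
open Summit.ABC.ABC.Theorems.SteinbergCore.Negative (one_le_primeToSix_iff)
open Summit.ABC.ABC.Theorems.FreyDegreeBound.Negative (conductorNorm_freyCurve_unbounded)

/-- **`0 < ε` is load-bearing in `stub_primeToSixDegreeBound`.**  Granting `FreyModularity`, the stub with the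
guard `0 < ε` dropped is false: take `ε = −3` and its constant `C`, a Frey curve `E_(a,b)` of conductor
`N > max C 0` (`conductorNorm_freyCurve_unbounded`) and a minimal datum `D` on it (`FreyModularity`,
`exists_minimal_datum`); then `1 ≤ cps (deg D) ≤ C · N^(2−3) = C / N < 1`. [folklore] -/
theorem primeToSixDegreeBound_false_without_eps_pos : Summit.ABC.ABC.Theses.DefiniteXi.FreyModularity → ¬ (∀ ε : ℝ, ∃ C : ℝ, ∀ a b : ℤ, IsCoprime a b → a * b * (a + b) ≠ 0 → ∀ (N : ℕ) [NeZero N], (Literature.NumberTheory.EllipticCurves.freyCurve a b).conductorNorm ℤ = N → ∀ D : Literature.NumberTheory.EllipticCurves.ModularForms.ModularParametrizationData (Literature.NumberTheory.EllipticCurves.freyCurve a b) N, (∀ D' : Literature.NumberTheory.EllipticCurves.ModularForms.ModularParametrizationData (Literature.NumberTheory.EllipticCurves.freyCurve a b) N, D.deg ≤ D'.deg) → ((D.deg / (ordProj[2] D.deg * ordProj[3] D.deg) : ℕ) : ℝ) ≤ C * (N : ℝ) ^ (2 + ε)) := by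
  intro hMod h
  obtain ⟨C, hC⟩ := h (-3)
  -- a Frey curve of conductor `N > max C 0`
  obtain ⟨a, b, hab, h0, hM⟩ := conductorNorm_freyCurve_unbounded ⌈max C 0⌉₊
  haveI := isElliptic_freyCurve h0
  set N : ℕ := (freyCurve a b).conductorNorm ℤ with hN
  haveI : NeZero N := ⟨((freyCurve a b).conductorNorm_pos_holds).ne'⟩
  -- a minimal datum on it
  obtain ⟨D, -, hDmin⟩ := exists_minimal_datum (hMod a b hab h0 N rfl)
  have hle := hC a b hab h0 N rfl D hDmin
  -- `1 ≤ cps (deg D)`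
  have h1 : (1 : ℝ) ≤ ((D.deg / (ordProj[2] D.deg * ordProj[3] D.deg) : ℕ) : ℝ) := by
    exact_mod_cast (one_le_primeToSix_iff _).mpr D.deg_pos.ne'
  -- `C · N^(2 − 3) = C / N < 1`
  have hNpos : (0 : ℝ) < (N : ℝ) := by exact_mod_cast Nat.pos_of_ne_zero (NeZero.ne N)
  have hrpow : (N : ℝ) ^ ((2 : ℝ) + -3) = (N : ℝ)⁻¹ := by
    rw [show (2 : ℝ) + -3 = -1 by norm_num, Real.rpow_neg_one]
  rw [hrpow] at hle
  have hN0' : max C 0 < (N : ℝ) := by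
    have h2 : ⌈max C 0⌉₊ < N := hM
    exact_mod_cast Nat.lt_of_ceil_lt h2
  have hlt : C * (N : ℝ)⁻¹ < 1 :=
    calc C * (N : ℝ)⁻¹ ≤ max C 0 * (N : ℝ)⁻¹ :=
          mul_le_mul_of_nonneg_right (le_max_left _ _) (inv_nonneg.mpr hNpos.le)
      _ < (N : ℝ) * (N : ℝ)⁻¹ := mul_lt_mul_of_pos_right hN0' (inv_pos.mpr hNpos)
      _ = 1 := mul_inv_cancel₀ hNpos.ne'
  exact (not_le.mpr hlt) (h1.trans hle)

end Summit.ABC.ABC.Theorems.SteinbergCorePrimeToSixEpsPos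

end
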